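import Summits.CriticalPhenomena.CardyFormulaZ2.Theorems.SegmentOpen.Negative.MarginalNotAnalytic

/-!
# `SegmentOpen` (stmt-CriticalPhenomena-5471), line `Sketch`: even ALL-ORDERS marginality does not
# give uniform analyticity

Negative-side support for the crux `CardySelfDualSegment.SegmentOpen` (cdisprove unit, cycle 2; work
file `Cruxes/SegmentOpen/Disproof.lean`, §5).  Card `vitali-transfer-smirnov-germ` / line `Sketch`
describe the research stub S4 `stub_uniformComplexBound` (UA: the crossing polynomials are bounded on
one complex disc around `t₀`, uniformly in the mesh) as "all-orders marginality".  The two are NOT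
the same: UA implies, by Cauchy estimates, that every Taylor coefficient at `t₀` is bounded uniformly
in the mesh ("marginal to all orders"), but the converse fails.  Sharpening
`MarginalNotAnalytic.lean`, the family

  `p_n = e^{-2√n} · (4X(1-X))^n`

is `[0,1]`-valued and uniformly `4`-Lipschitz on `[0,1]` (UM shape), has ALL its Taylor coefficients
at `t₀ = 1/2` bounded uniformly in `n` (indeed `|c_k(p_n)| ≤ e^{-2√n}(4n)^k ≤ (2k)!`, and they tend
to `0`), and still `|p_n(1/2 + iy)| = e^{-2√n}(1+4y²)^n → ∞` for every `y ≠ 0`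
(`exists_allOrders_marginal_family_not_uniformComplexBound`,
`not_uniformComplexBound_of_allOrders_marginal_abstract`).  So no perturbative statement at `t₀`
— bounded `t`-derivatives of every order, even convergent jets — can deliver S4; UA is a genuinely
non-perturbative (Lee–Yang type) property of the corner model.
-/

noncomputable section

namespace Summit.CriticalPhenomena.CardyFormulaZ2.Theorems.SegmentOpen.Negative

open Set Filter Topology Complex Polynomial

/-! ## §1 The centred logistic polynomial `q = 1 - 4X²` and the coefficients of its powers -/

/-- Coefficient recursion for `(1 - 4X²)^{n+1} = (1 - 4X²)^n - 4·X²·(1 - 4X²)^n`. [folklore] -/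
theorem coeff_centredLogistic_pow_succ (n k : ℕ) :
    ((1 - C (4 : ℝ) * X ^ 2) ^ (n + 1)).coeff k =
      ((1 - C (4 : ℝ) * X ^ 2) ^ n).coeff k -
        4 * (if 2 ≤ k then ((1 - C (4 : ℝ) * X ^ 2) ^ n).coeff (k - 2) else 0) := by
  have h : (1 - C (4 : ℝ) * X ^ 2) ^ (n + 1) =
      (1 - C (4 : ℝ) * X ^ 2) ^ n - C 4 * ((1 - C (4 : ℝ) * X ^ 2) ^ n * X ^ 2) := by ring
  rw [h, coeff_sub, coeff_C_mul, coeff_mul_X_pow']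

/-- `|coeff_k (1 - 4X²)^n| ≤ (4n)^k`. [folklore] -/
theorem abs_coeff_centredLogistic_pow_le (n k : ℕ) :
    |((1 - C (4 : ℝ) * X ^ 2) ^ n).coeff k| ≤ (4 * (n : ℝ)) ^ k := by
  induction n generalizing k with
  | zero =>
    rw [pow_zero, coeff_one]
    rcases Nat.eq_zero_or_pos k with rfl | hk
    · simp
    · rw [if_neg hk.ne', abs_zero]
      positivity
  | succ n ih =>
    rw [coeff_centredLogistic_pow_succ]
    by_cases hk : 2 ≤ k
    · rw [if_pos hk]
      obtain ⟨j, rfl⟩ : ∃ j, k = j + 2 := ⟨k - 2, by omega⟩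
      rw [Nat.add_sub_cancel]
      set c₂ : ℝ := ((1 - C (4 : ℝ) * X ^ 2) ^ n).coeff (j + 2) with hc₂
      set c₀ : ℝ := ((1 - C (4 : ℝ) * X ^ 2) ^ n).coeff j with hc₀
      have h1 : |c₂| ≤ (4 * (n : ℝ)) ^ (j + 2) := ih (j + 2)
      have h2 : |c₀| ≤ (4 * (n : ℝ)) ^ j := ih j
      have hn : (0 : ℝ) ≤ 4 * (n : ℝ) := by positivity
      have step : |c₂ - 4 * c₀| ≤ |c₂| + 4 * |c₀| := by
        have h := abs_sub c₂ (4 * c₀)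
        rwa [abs_mul, abs_of_pos (by norm_num : (0 : ℝ) < 4)] at h
      calc |c₂ - 4 * c₀| ≤ |c₂| + 4 * |c₀| := step
        _ ≤ (4 * (n : ℝ)) ^ (j + 2) + 4 * (4 * (n : ℝ)) ^ j := by gcongr
        _ = ((4 * (n : ℝ)) ^ 2 + 4) * (4 * (n : ℝ)) ^ j := by ring
        _ ≤ (4 * ((n + 1 : ℕ) : ℝ)) ^ 2 * (4 * ((n + 1 : ℕ) : ℝ)) ^ j := by
            push_cast
            gcongr
            · nlinarith
            · linarith
        _ = (4 * ((n + 1 : ℕ) : ℝ)) ^ (j + 2) := by ring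
    · rw [if_neg hk, mul_zero, sub_zero]
      calc |((1 - C (4 : ℝ) * X ^ 2) ^ n).coeff k| ≤ (4 * (n : ℝ)) ^ k := ih k
        _ ≤ (4 * ((n + 1 : ℕ) : ℝ)) ^ k := by
            push_cast
            gcongr
            linarith

/-! ## §2 The damping `a_n = e^{-2√n}` -/

/-- `e^{-2√n} · (4n)^k ≤ (2k)!` (from `x^m/m! ≤ e^x` at `x = 2√n`, `m = 2k`). [folklore] -/
theorem exp_neg_two_sqrt_mul_pow_le (n k : ℕ) :
    Real.exp (-2 * Real.sqrt n) * (4 * (n : ℝ)) ^ k ≤ ((2 * k).factorial : ℝ) := by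
  have hx : (0 : ℝ) ≤ 2 * Real.sqrt n := by positivity
  have h := Real.pow_div_factorial_le_exp (2 * Real.sqrt n) hx (2 * k)
  have hpow : (2 * Real.sqrt n) ^ (2 * k) = (4 * (n : ℝ)) ^ k := by
    rw [pow_mul, mul_pow, Real.sq_sqrt (Nat.cast_nonneg n)]; norm_num
  rw [hpow, div_le_iff₀ (by positivity)] at h
  rw [show -2 * Real.sqrt n = -(2 * Real.sqrt n) by ring, Real.exp_neg]
  have hpos : 0 < Real.exp (2 * Real.sqrt n) := Real.exp_pos _
  rw [inv_mul_le_iff₀ hpos]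
  linarith [mul_comm (Real.exp (2 * Real.sqrt ↑n)) ((2 * k).factorial : ℝ)]

/-- `n · e^{-2√n} ≤ 1`. [folklore] -/
theorem nat_mul_exp_neg_two_sqrt_le_one (n : ℕ) : (n : ℝ) * Real.exp (-2 * Real.sqrt n) ≤ 1 := by
  have h := exp_neg_two_sqrt_mul_pow_le n 1
  simp only [pow_one, mul_one, Nat.factorial_two, Nat.cast_ofNat] at h
  nlinarith [Real.exp_pos (-2 * Real.sqrt n), h]

/-- `e^{-2√n} · b^n → ∞` for `b > 1` (exponential beats `e^{2√n}`: `2√n ≤ εn + 1/ε`). [folklore] -/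
theorem tendsto_exp_neg_two_sqrt_mul_pow {b : ℝ} (hb : 1 < b) :
    Tendsto (fun n : ℕ => Real.exp (-2 * Real.sqrt n) * b ^ n) atTop atTop := by
  set ε : ℝ := (b - 1) / (2 * b) with hε
  have hb0 : 0 < b := by linarith
  have hεpos : 0 < ε := by rw [hε]; exact div_pos (by linarith) (by linarith)
  -- `b e^{-ε} ≥ b (1 - ε) = (b+1)/2 > 1`
  have hbase : (b + 1) / 2 ≤ b * Real.exp (-ε) := by
    have h1 : -ε + 1 ≤ Real.exp (-ε) := Real.add_one_le_exp (-ε)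
    have h2 : b * (-ε + 1) = (b + 1) / 2 := by rw [hε]; field_simp; ring
    rw [← h2]; exact mul_le_mul_of_nonneg_left h1 hb0.le
  have hgt : 1 < (b + 1) / 2 := by linarith
  have hlow : ∀ n : ℕ, Real.exp (-(1 / ε)) * ((b + 1) / 2) ^ n ≤ Real.exp (-2 * Real.sqrt n) * b ^ n := by
    intro n
    have hs : 2 * Real.sqrt n ≤ ε * n + 1 / ε := by
      have hε0 : ε ≠ 0 := hεpos.ne'
      have key : 0 ≤ ε * (Real.sqrt n - 1 / ε) ^ 2 := by positivity
      have expand : ε * (Real.sqrt n - 1 / ε) ^ 2 = ε * (Real.sqrt n) ^ 2 - 2 * Real.sqrt n + 1 / ε := by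
        field_simp
        ring
      rw [expand, Real.sq_sqrt (Nat.cast_nonneg n)] at key
      linarith
    calc Real.exp (-(1 / ε)) * ((b + 1) / 2) ^ n ≤ Real.exp (-(1 / ε)) * (b * Real.exp (-ε)) ^ n := by
          gcongr
      _ = Real.exp (-(ε * n + 1 / ε)) * b ^ n := by
          rw [mul_pow, ← Real.exp_nat_mul, mul_comm (b ^ n), ← mul_assoc, ← Real.exp_add]
          congr 1; ring_nf
      _ ≤ Real.exp (-2 * Real.sqrt n) * b ^ n := by
          gcongr
          linarith
  refine tendsto_atTop_mono hlow ?_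
  exact Tendsto.const_mul_atTop (Real.exp_pos _) (tendsto_pow_atTop_atTop_of_one_lt hgt)

/-! ## §3 The witness family `p_n = e^{-2√n} (4X(1-X))^n`, written as
`(C a_n · (1 - 4X²)^n) ∘ (X - 1/2)` so that its Taylor expansion at `1/2` is explicit -/

/-! The damped family is written out as `((C e^{-2√n} * (1 - C 4 * X^2)^n).comp (X - C (1/2)))`
(no definition or notation is introduced). -/

/-- Its Taylor expansion at `1/2` is `C a_n · (1 - 4X²)^n`. [folklore] -/
theorem taylor_dampedWitness (n : ℕ) :
    taylor (1 / 2 : ℝ) ((C (Real.exp (-2 * Real.sqrt n)) * (1 - C (4 : ℝ) * X ^ 2) ^ n).comp (X - C (1 / 2 : ℝ))) = C (Real.exp (-2 * Real.sqrt n)) * (1 - C (4 : ℝ) * X ^ 2) ^ n := by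
  rw [taylor_apply, comp_assoc]
  have : (X - C (1 / 2 : ℝ)).comp (X + C (1 / 2 : ℝ)) = X := by
    rw [sub_comp, X_comp, C_comp]; ring
  rw [this, comp_X]

/-- Real evaluation: `p_n(t) = e^{-2√n} (4t(1-t))^n`. [folklore] -/
theorem eval_dampedWitness (n : ℕ) (t : ℝ) :
    ((C (Real.exp (-2 * Real.sqrt n)) * (1 - C (4 : ℝ) * X ^ 2) ^ n).comp (X - C (1 / 2 : ℝ))).eval t = Real.exp (-2 * Real.sqrt n) * (4 * t * (1 - t)) ^ n := by
  rw [eval_comp, eval_sub, eval_X, eval_C, eval_mul, eval_C, eval_pow, eval_sub,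
    eval_one, eval_mul, eval_C, eval_pow, eval_X]
  congr 1
  congr 1
  ring

/-- Complex evaluation: `p_n(z) = e^{-2√n} (4z(1-z))^n`. [folklore] -/
theorem eval_map_dampedWitness (n : ℕ) (z : ℂ) :
    (((C (Real.exp (-2 * Real.sqrt n)) * (1 - C (4 : ℝ) * X ^ 2) ^ n).comp (X - C (1 / 2 : ℝ))).map (algebraMap ℝ ℂ)).eval z =
      ((Real.exp (-2 * Real.sqrt n) : ℝ) : ℂ) * (4 * z * (1 - z)) ^ n := by
  rw [map_comp, Polynomial.map_mul, map_C, Polynomial.map_pow, Polynomial.map_sub,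
    Polynomial.map_one, Polynomial.map_mul, map_C, Polynomial.map_pow, map_X, Polynomial.map_sub,
    map_X, map_C, eval_comp, eval_sub, eval_X, eval_C, eval_mul, eval_C, eval_pow, eval_sub, eval_one,
    eval_mul, eval_C, eval_pow, eval_X, Complex.coe_algebraMap]
  congr 1
  push_cast
  ring

/-- The damped family is `4`-Lipschitz on `[0,1]` (derivative `e^{-2√n} n (4t(1-t))^{n-1}(4-8t)`,
and `n e^{-2√n} ≤ 1`). [folklore] -/
theorem dampedWitness_lipschitz (n : ℕ) {s t : ℝ} (hs : s ∈ Icc (0 : ℝ) 1) (ht : t ∈ Icc (0 : ℝ) 1) :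
    |Real.exp (-2 * Real.sqrt n) * (4 * t * (1 - t)) ^ n -
        Real.exp (-2 * Real.sqrt n) * (4 * s * (1 - s)) ^ n| ≤ 4 * |t - s| := by
  set a : ℝ := Real.exp (-2 * Real.sqrt n) with ha
  have ha0 : 0 < a := Real.exp_pos _
  set f : ℝ → ℝ := fun u => a * (4 * u * (1 - u)) ^ n with hf
  have hderiv : ∀ u : ℝ, HasDerivAt f (a * ((n : ℝ) * (4 * u * (1 - u)) ^ (n - 1) * (4 - 8 * u))) u := by
    intro u
    have h1 : HasDerivAt (fun u : ℝ => 4 * u) 4 u := by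
      have := (hasDerivAt_id' u).const_mul (4 : ℝ)
      simpa using this
    have h2 : HasDerivAt (fun u : ℝ => 1 - u) (-1) u := (hasDerivAt_id' u).const_sub 1
    have h3 : HasDerivAt (fun u : ℝ => 4 * u * (1 - u)) (4 * (1 - u) + 4 * u * (-1)) u := h1.mul h2
    have h4 := (h3.pow n).const_mul a
    refine h4.congr_deriv ?_
    ring
  have hbound : ∀ u ∈ Icc (0 : ℝ) 1, ‖a * ((n : ℝ) * (4 * u * (1 - u)) ^ (n - 1) * (4 - 8 * u))‖ ≤ 4 := by
    intro u hu
    have hq := logistic_mem_Icc hu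
    have hp : (4 * u * (1 - u)) ^ (n - 1) ≤ 1 := pow_le_one₀ hq.1 hq.2
    have hpn : 0 ≤ (4 * u * (1 - u)) ^ (n - 1) := pow_nonneg hq.1 _
    have hau : |4 - 8 * u| ≤ 4 := by rw [abs_le]; constructor <;> linarith [hu.1, hu.2]
    have hna : (n : ℝ) * a ≤ 1 := by rw [ha]; exact nat_mul_exp_neg_two_sqrt_le_one n
    rw [Real.norm_eq_abs, abs_mul, abs_of_pos ha0, abs_mul, abs_mul, abs_of_nonneg hpn,
      abs_of_nonneg (Nat.cast_nonneg n)]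
    calc a * ((n : ℝ) * (4 * u * (1 - u)) ^ (n - 1) * |4 - 8 * u|)
        = ((n : ℝ) * a) * ((4 * u * (1 - u)) ^ (n - 1) * |4 - 8 * u|) := by ring
      _ ≤ 1 * (1 * 4) := by
          apply mul_le_mul hna _ (by positivity) zero_le_one
          exact mul_le_mul hp hau (abs_nonneg _) zero_le_one
      _ = 4 := by norm_num
  have key := (convex_Icc (0 : ℝ) 1).norm_image_sub_le_of_norm_hasDerivWithin_le
    (fun u _ => (hderiv u).hasDerivWithinAt) hbound hs ht
  simpa [hf, Real.norm_eq_abs] using key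

/-! ## §4 The statements -/

/-- **An all-orders-marginal family that is not uniformly analytic.**  There is a sequence of real
polynomials with values in `[0,1]` on `[0,1]`, uniformly `4`-Lipschitz on `[0,1]` (UM shape), ALL of
whose Taylor coefficients at `t₀ = 1/2` are bounded uniformly in `n` (marginal to all orders; bound
`(2k)!` at order `k`), whose complexifications are nevertheless unbounded on every disc around
`1/2`: `p_n = e^{-2√n}(4X(1-X))^n`. [folklore] -/
theorem exists_allOrders_marginal_family_not_uniformComplexBound :
    ∃ p : ℕ → Polynomial ℝ,
      (∀ (n : ℕ) (t : ℝ), t ∈ Icc (0 : ℝ) 1 → (p n).eval t ∈ Icc (0 : ℝ) 1) ∧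
      (∀ (n : ℕ) (s t : ℝ), s ∈ Icc (0 : ℝ) 1 → t ∈ Icc (0 : ℝ) 1 →
        |(p n).eval t - (p n).eval s| ≤ 4 * |t - s|) ∧
      (∀ k : ℕ, ∃ B : ℝ, ∀ n : ℕ, |(taylor (1 / 2 : ℝ) (p n)).coeff k| ≤ B) ∧
      ∀ r > 0, ∀ K : ℝ, ∃ n : ℕ, ∃ z ∈ Metric.ball (((1 / 2 : ℝ)) : ℂ) r,
        K < ‖((p n).map (algebraMap ℝ ℂ)).eval z‖ := by
  refine ⟨fun n => ((C (Real.exp (-2 * Real.sqrt n)) * (1 - C (4 : ℝ) * X ^ 2) ^ n).comp (X - C (1 / 2 : ℝ))), ?_, ?_, ?_, ?_⟩ <;> beta_reduce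
  · intro n t ht
    rw [eval_dampedWitness]
    have hq := logistic_mem_Icc ht
    have ha0 : 0 < Real.exp (-2 * Real.sqrt n) := Real.exp_pos _
    have ha1 : Real.exp (-2 * Real.sqrt n) ≤ 1 := by
      rw [Real.exp_le_one_iff]
      have := Real.sqrt_nonneg (n : ℝ)
      linarith
    constructor
    · exact mul_nonneg ha0.le (pow_nonneg hq.1 _)
    · calc Real.exp (-2 * Real.sqrt n) * (4 * t * (1 - t)) ^ n ≤ 1 * 1 :=
            mul_le_mul ha1 (pow_le_one₀ hq.1 hq.2) (pow_nonneg hq.1 _) zero_le_one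
        _ = 1 := one_mul 1
  · intro n s t hs ht
    rw [eval_dampedWitness, eval_dampedWitness]
    exact dampedWitness_lipschitz n hs ht
  · intro k
    refine ⟨((2 * k).factorial : ℝ), fun n => ?_⟩
    rw [taylor_dampedWitness, coeff_C_mul, abs_mul, abs_of_pos (Real.exp_pos _)]
    calc Real.exp (-2 * Real.sqrt n) * |((1 - C (4 : ℝ) * X ^ 2) ^ n).coeff k|
        ≤ Real.exp (-2 * Real.sqrt n) * (4 * (n : ℝ)) ^ k := by
          gcongr; exact abs_coeff_centredLogistic_pow_le n k
      _ ≤ ((2 * k).factorial : ℝ) := exp_neg_two_sqrt_mul_pow_le n k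
  · intro r hr K
    set b : ℝ := 1 + r ^ 2 with hb
    have hb1 : 1 < b := by rw [hb]; nlinarith
    have hlim := tendsto_exp_neg_two_sqrt_mul_pow hb1
    obtain ⟨n, hn⟩ := (hlim.eventually_gt_atTop K).exists
    set z : ℂ := ((1 / 2 : ℝ) : ℂ) + ((r / 2 : ℝ) : ℂ) * I with hz
    refine ⟨n, z, ?_, ?_⟩
    · rw [Metric.mem_ball, dist_eq_norm, hz, add_sub_cancel_left, norm_mul, Complex.norm_real,
        Complex.norm_I, mul_one, Real.norm_of_nonneg (by positivity)]
      linarith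
    · have hw : (4 : ℂ) * z * (1 - z) = (b : ℂ) := by
        have : (4 : ℂ) * z * (1 - z) = 1 - 4 * (((r / 2 : ℝ) : ℂ) * I) ^ 2 := by rw [hz]; push_cast; ring
        rw [this, mul_pow, Complex.I_sq, hb]
        push_cast
        ring
      rw [eval_map_dampedWitness, hw, norm_mul, norm_pow, Complex.norm_real, Complex.norm_real,
        Real.norm_of_nonneg (Real.exp_pos _).le, Real.norm_of_nonneg (by positivity)]
      exact hn

/-- **All-orders marginality ⇏ UA in the abstract**: it is NOT true that every `[0,1]`-valued
polynomial family with the UniformMarginality shape AND uniformly bounded Taylor coefficients of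
every order at `t₀ = 1/2` is bounded on a complex disc around `1/2` uniformly in the index.  The
identification "S4 = all-orders marginality" is therefore one-directional (UA ⊢ bounded jets, not
conversely): `stub_uniformComplexBound` is a non-perturbative claim. [folklore] -/
theorem not_uniformComplexBound_of_allOrders_marginal_abstract :
    ¬ ∀ p : ℕ → Polynomial ℝ,
        (∀ (n : ℕ) (t : ℝ), t ∈ Icc (0 : ℝ) 1 → (p n).eval t ∈ Icc (0 : ℝ) 1) →
        (∀ ε > 0, ∃ η > 0, ∀ (n : ℕ) (s t : ℝ), s ∈ Icc (0 : ℝ) 1 → t ∈ Icc (0 : ℝ) 1 →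
          |t - s| < η → |(p n).eval t - (p n).eval s| < ε) →
        (∀ k : ℕ, ∃ B : ℝ, ∀ n : ℕ, |(taylor (1 / 2 : ℝ) (p n)).coeff k| ≤ B) →
        ∃ r > 0, ∃ K : ℝ, ∀ (n : ℕ), ∀ z ∈ Metric.ball (((1 / 2 : ℝ)) : ℂ) r,
          ‖((p n).map (algebraMap ℝ ℂ)).eval z‖ ≤ K := by
  intro h
  obtain ⟨p, hval, hlip, hjet, hblow⟩ := exists_allOrders_marginal_family_not_uniformComplexBound
  have hUM : ∀ ε > 0, ∃ η > 0, ∀ (n : ℕ) (s t : ℝ), s ∈ Icc (0 : ℝ) 1 → t ∈ Icc (0 : ℝ) 1 →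
      |t - s| < η → |(p n).eval t - (p n).eval s| < ε := by
    intro ε hε
    refine ⟨ε / 4, by positivity, fun n s t hs ht hst => ?_⟩
    calc |(p n).eval t - (p n).eval s| ≤ 4 * |t - s| := hlip n s t hs ht
      _ < 4 * (ε / 4) := by gcongr
      _ = ε := by ring
  obtain ⟨r, hr, K, hK⟩ := h p hval hUM hjet
  obtain ⟨n, z, hz, hlt⟩ := hblow r hr K
  exact (lt_irrefl K) (hlt.trans_le (hK n z hz))

end Summit.CriticalPhenomena.CardyFormulaZ2.Theorems.SegmentOpen.Negative

end
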